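import Literature.AlgebraicGeometry.ShimuraVarieties.UnitaryAuxiliarySymplecticModule
import Literature.AlgebraicGeometry.ModuliOfAbelianVarieties.SiegelComplexRecordSystem
import Literature.NumberTheory.ComplexMultiplication.ReflexNormIdeles
import Literature.NumberTheory.AdelicBaseChange.FiniteAdeleGaloisDescent
import HarnessLib

/-!
# The group-map carrier `U(H)(𝔸_f) × T₀(M)(𝔸_f) → GSp_δ(𝔸_{ℚ,f})` and `U(H)(ℚ) × T₀(M)(ℚ) → GSp_δ(ℚ)` of the symplectic
# embedding of the twisted unitary datum (Deligne 1979, Prop. 2.3.10 — adelic and rational points, and their square)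

Topic `AlgebraicGeometry/ShimuraVarieties`; namespace `Literature.AlgebraicGeometry.ShimuraVarieties.UnitaryCanonicalModel.Aux`.
Definitions with bodies and theorems; no named fact, no instance, nothing asserted (net debt 0).  Layer (g-a3) of the I-1′
receptacle: the representation on `R`-points ★ `auxRep R F : (R ⊗_ℚ M)ˣ × GL₃(R ⊗_ℚ M) →* GL_{g⊕g}(R)` of
★ `UnitaryAuxiliarySymplecticModule` (lands in `GSp_δ(R)` under the torus and unitary conditions, ★
`auxRep_mem_similitudeGroupOfForm`) is fed with the tree's ACTUAL adelic groups — ★ `UnitaryGroup.finAdelic F L c 3 H ≤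
GL₃(𝔸_{L,f})` and ★ `Aux.torusFinAdelic M ≤ (𝔸_{M,f})ˣ` — through the base-change isomorphism ★
`ComplexMultiplication.ratFiniteAdeleTensorEquiv : 𝔸_{ℚ,f} ⊗_ℚ k ≃+* 𝔸_{k,f}` (Cassels–Fröhlich II (14.2)), and with the
rational groups ★ `UnitaryGroup.rational` / ★ `Aux.torusRat` through `ℚ ⊗_ℚ M ≅ M`:

* `ringHom_complexConj` — an embedding of CM fields commutes with complex conjugation; `conjFiniteAdele_ratFiniteAdeleTensorEquiv`
  — under `𝔸_{ℚ,f} ⊗ M ≅ 𝔸_{M,f}` the Galois action of `c` (★ `conjFiniteAdele`) is `1 ⊗ c` (★ Galois descent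
  `smul_finiteAdeleRing_mapSemialgHom`, `restrictScalars_smul_finiteAdeleRing`, `FiniteAdeleRing.smul_algebraMap`).
* `unitaryToTensorFin`, `torusToTensorFin` (transports) with `unitaryToTensorFin_unitary`, `torusToTensorFin_cond`;
  **`auxToGspFin F : U(H)(𝔸_f) × T₀(M)(𝔸_f) →* gspFinAdelic δ`**, `(a, t) ↦ (t, t·(a ⊗ 1))` in the frame — R-f's
  `(a ⊗ t_p, t_p)`.
* `auxToGspRat F : U(H)(ℚ) × T₀(M)(ℚ) →* gspRational δ` and **`gspRationalToFinAdelic_auxToGspRat`**: the square with ★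
  `gspRationalToFinAdelic`, ★ `rationalToFinAdelic`, ★ `toTorusFinAdelic` commutes (naturality of `auxRep` in `R`,
  `auxRep_map`) — what makes the Shimura-set map `[x, a], p ↦ [J_{x,Φ}, auxToGspFin (a, t_p)]` of (g-b) well defined.

## References
* [Deligne1979ShimuraVarieties] P. Deligne, *Variétés de Shimura* (1979), Prop. 2.3.10, 2.1.2 (PDF pp. 32, 24 of Milne's translation).
* [CasselsFrohlichANT1967] Cassels–Fröhlich, *Algebraic Number Theory*, Ch. II §14 (14.2), Ch. VII §1.1.
* [Milne2005ShimuraVarieties] J. S. Milne, *Introduction to Shimura varieties* (2005), §5 p. 57, §6 p. 67.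
-/

set_option autoImplicit false

noncomputable section

open Matrix NumberField IsDedekindDomain
open scoped TensorProduct

namespace Literature.AlgebraicGeometry.ShimuraVarieties

namespace UnitaryCanonicalModel

namespace Aux

open Literature.AlgebraicGeometry.ModuliOfAbelianVarieties
open Literature.NumberTheory.ComplexMultiplication (ratFiniteAdeleTensorEquiv ratFiniteAdeleTensorEquiv_tmul
  ratFiniteAdeleTensorEquiv_symm_algebraMap)
open Literature.NumberTheory.Automorphic Literature.NumberTheory.Automorphic.UnitaryGroup
open Literature.NumberTheory.AdelicBaseChange (smul_finiteAdeleRing_mapSemialgHom restrictScalars_smul_finiteAdeleRing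
  finiteAdeleRing_mapSemialgHom_apply_eq_baseChange)

/-! ### §1. Complex conjugation: along `j : L → M` and along `𝔸_{ℚ,f} ⊗ M ≅ 𝔸_{M,f}` -/

section Conj

variable {L : Type} [Field L] [NumberField L] [IsCMField L] (M : Type) [Field M] [NumberField M] [IsCMField M]

/-- **An embedding of CM fields commutes with complex conjugation**: `j(c_L x) = c_M(j x)` (read through any complex
embedding of `M`, Mathlib ★ `IsCMField.complexEmbedding_complexConj`). [cite: Deligne1979ShimuraVarieties, 2.3.9 (PDF p. 32)] -/
theorem ringHom_complexConj (j : L →+* M) (x : L) :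
    j (IsCMField.complexConj L x) = IsCMField.complexConj M (j x) := by
  obtain ⟨φ⟩ : Nonempty (M →+* ℂ) := inferInstance
  apply φ.injective
  rw [IsCMField.complexEmbedding_complexConj M φ]
  exact IsCMField.complexEmbedding_complexConj L (φ.comp j) x

/-- `(1 ⊗ j) ∘ (1 ⊗ c_L) = (1 ⊗ c_M) ∘ (1 ⊗ j)` on `R ⊗_ℚ L`. [cite: Deligne1979ShimuraVarieties, 2.3.9 (PDF p. 32)] -/
theorem tensorMap_conjR (R : Type) [CommRing R] [Algebra ℚ R] (j : L →+* M) (z : R ⊗[ℚ] L) :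
    Algebra.TensorProduct.map (AlgHom.id R R) j.toRatAlgHom (conjR L R z) =
      conjR M R (Algebra.TensorProduct.map (AlgHom.id R R) j.toRatAlgHom z) := by
  induction z using TensorProduct.induction_on with
  | zero => simp
  | tmul r y => simp [conjR_tmul, Algebra.TensorProduct.map_tmul, ringHom_complexConj M j]
  | add a b ha hb => rw [map_add, map_add, ha, hb, map_add, map_add]

/-- **Under `𝔸_{ℚ,f} ⊗_ℚ M ≅ 𝔸_{M,f}` the Galois action of complex conjugation is `1 ⊗ c`.**  On pure tensors
`r ⊗ a ↦ (a)·con(r)`: `c` fixes `con(𝔸_{ℚ,f})` (Galois descent, ★ `smul_finiteAdeleRing_mapSemialgHom`) and acts on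
principal adèles through `M` (★ `FiniteAdeleRing.smul_algebraMap`). [cite: CasselsFrohlichANT1967, Ch. VII §1.1 and Ch. II §14 (14.2)] -/
theorem conjFiniteAdele_ratFiniteAdeleTensorEquiv (z : FiniteAdeleRing (𝓞 ℚ) ℚ ⊗[ℚ] M) :
    conjFiniteAdele (↥(maximalRealSubfield M)) M (IsCMField.complexConj M) (ratFiniteAdeleTensorEquiv M z) =
      ratFiniteAdeleTensorEquiv M (conjR M (FiniteAdeleRing (𝓞 ℚ) ℚ) z) := by
  induction z using TensorProduct.induction_on with
  | zero => simp
  | tmul r a =>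
      rw [conjR_tmul, ratFiniteAdeleTensorEquiv_tmul, ratFiniteAdeleTensorEquiv_tmul, map_mul, conjFiniteAdele_apply,
        conjFiniteAdele_apply, FiniteAdeleRing.smul_algebraMap, AlgEquiv.smul_def,
        ← restrictScalars_smul_finiteAdeleRing (↥(maximalRealSubfield M)) M (IsCMField.complexConj M),
        smul_finiteAdeleRing_mapSemialgHom]
  | add a b ha hb => rw [map_add, map_add, ha, hb, map_add, map_add]

/-- The inverse form: `e⁻¹(c • y) = (1 ⊗ c)(e⁻¹ y)`. [cite: CasselsFrohlichANT1967, Ch. VII §1.1] -/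
theorem ratFiniteAdeleTensorEquiv_symm_conjFiniteAdele (y : FiniteAdeleRing (𝓞 M) M) :
    (ratFiniteAdeleTensorEquiv M).symm (conjFiniteAdele (↥(maximalRealSubfield M)) M (IsCMField.complexConj M) y) =
      conjR M (FiniteAdeleRing (𝓞 ℚ) ℚ) ((ratFiniteAdeleTensorEquiv M).symm y) := by
  apply (ratFiniteAdeleTensorEquiv M).injective
  rw [RingEquiv.apply_symm_apply, ← conjFiniteAdele_ratFiniteAdeleTensorEquiv, RingEquiv.apply_symm_apply]

end Conj

/-! ### §2. Transport of `U(H)(𝔸_f)` and `T₀(M)(𝔸_f)` to `𝔸_{ℚ,f} ⊗_ℚ M` -/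

section Transport

variable {L : Type} [Field L] [NumberField L] [IsCMField L] (M : Type) [Field M] [NumberField M] [IsCMField M]
  (j : L →+* M) (H : Matrix (Fin 3) (Fin 3) L)

/-- The ring homomorphism `𝔸_{L,f} → 𝔸_{ℚ,f} ⊗_ℚ M`, `(𝔸_{ℚ,f} ⊗ L ≅ 𝔸_{L,f})⁻¹` followed by `1 ⊗ j`. [cite: CasselsFrohlichANT1967, Ch. II §14 (14.2)] -/
def finAdeleToTensor : FiniteAdeleRing (𝓞 L) L →+* FiniteAdeleRing (𝓞 ℚ) ℚ ⊗[ℚ] M :=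
  ((Algebra.TensorProduct.map (AlgHom.id (FiniteAdeleRing (𝓞 ℚ) ℚ) (FiniteAdeleRing (𝓞 ℚ) ℚ)) j.toRatAlgHom :
      FiniteAdeleRing (𝓞 ℚ) ℚ ⊗[ℚ] L →+* FiniteAdeleRing (𝓞 ℚ) ℚ ⊗[ℚ] M)).comp
    (ratFiniteAdeleTensorEquiv L).symm.toRingHom

/-- `finAdeleToTensor` intertwines the Galois conjugation on `𝔸_{L,f}` with `1 ⊗ c_M`. [cite: CasselsFrohlichANT1967, Ch. VII §1.1] -/
theorem finAdeleToTensor_conjFiniteAdele (y : FiniteAdeleRing (𝓞 L) L) :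
    finAdeleToTensor M j (conjFiniteAdele (↥(maximalRealSubfield L)) L (IsCMField.complexConj L) y) =
      conjR M (FiniteAdeleRing (𝓞 ℚ) ℚ) (finAdeleToTensor M j y) := by
  change Algebra.TensorProduct.map _ _ ((ratFiniteAdeleTensorEquiv L).symm _) =
    conjR M _ (Algebra.TensorProduct.map _ _ ((ratFiniteAdeleTensorEquiv L).symm y))
  rw [ratFiniteAdeleTensorEquiv_symm_conjFiniteAdele, tensorMap_conjR]

omit [IsCMField L] [IsCMField M] in
/-- `finAdeleToTensor` on principal adèles: `(a)_{𝔸_{L,f}} ↦ 1 ⊗ j(a)`. [cite: CasselsFrohlichANT1967, Ch. II §14 (14.2)] -/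
theorem finAdeleToTensor_algebraMap (a : L) :
    finAdeleToTensor M j (algebraMap L (FiniteAdeleRing (𝓞 L) L) a) = (1 : FiniteAdeleRing (𝓞 ℚ) ℚ) ⊗ₜ j a := by
  change Algebra.TensorProduct.map _ _ ((ratFiniteAdeleTensorEquiv L).symm _) = _
  rw [ratFiniteAdeleTensorEquiv_symm_algebraMap]
  simp [Algebra.TensorProduct.map_tmul]

/-- **Transport of `U(H)(𝔸_f) ≤ GL₃(𝔸_{L,f})` into `GL₃(𝔸_{ℚ,f} ⊗_ℚ M)`** (entrywise `finAdeleToTensor`). [cite: Deligne1979ShimuraVarieties, Prop. 2.3.10 (PDF p. 32)] -/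
def unitaryToTensorFin :
    ↥(finAdelic (↥(maximalRealSubfield L)) L (IsCMField.complexConj L) 3 H) →* GL (Fin 3) (FiniteAdeleRing (𝓞 ℚ) ℚ ⊗[ℚ] M) :=
  (Matrix.GeneralLinearGroup.map (finAdeleToTensor M j)).comp (Subgroup.subtype _)

/-- The transported element is unitary for `H^j` over `𝔸_{ℚ,f} ⊗ M` in the `1 ⊗ c` convention of ★ `auxRep_mem_similitudeGroupOfForm`.
[cite: Deligne1979ShimuraVarieties, Prop. 2.3.10 (PDF p. 32)] -/
theorem unitaryToTensorFin_unitary (u : ↥(finAdelic (↥(maximalRealSubfield L)) L (IsCMField.complexConj L) 3 H)) :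
    ((unitaryToTensorFin M j H u : Matrix (Fin 3) (Fin 3) (FiniteAdeleRing (𝓞 ℚ) ℚ ⊗[ℚ] M)).map
          (conjR M (FiniteAdeleRing (𝓞 ℚ) ℚ)))ᵀ *
        (H.map j).map (Algebra.TensorProduct.includeRight : M →ₐ[ℚ] FiniteAdeleRing (𝓞 ℚ) ℚ ⊗[ℚ] M) *
        (unitaryToTensorFin M j H u : Matrix (Fin 3) (Fin 3) (FiniteAdeleRing (𝓞 ℚ) ℚ ⊗[ℚ] M)) =
      (H.map j).map (Algebra.TensorProduct.includeRight : M →ₐ[ℚ] FiniteAdeleRing (𝓞 ℚ) ℚ ⊗[ℚ] M) := by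
  have hu : (((u : GL (Fin 3) (FiniteAdeleRing (𝓞 L) L)) : Matrix (Fin 3) (Fin 3) (FiniteAdeleRing (𝓞 L) L)).map
        (conjFiniteAdele (↥(maximalRealSubfield L)) L (IsCMField.complexConj L)))ᵀ * finiteAdelicForm L 3 H *
        ((u : GL (Fin 3) (FiniteAdeleRing (𝓞 L) L)) : Matrix (Fin 3) (Fin 3) (FiniteAdeleRing (𝓞 L) L)) =
      finiteAdelicForm L 3 H := u.2
  have hcoe : (unitaryToTensorFin M j H u : Matrix (Fin 3) (Fin 3) (FiniteAdeleRing (𝓞 ℚ) ℚ ⊗[ℚ] M)) =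
      (((u : GL (Fin 3) (FiniteAdeleRing (𝓞 L) L)) : Matrix (Fin 3) (Fin 3) _)).map (finAdeleToTensor M j) := rfl
  have hH : (H.map j).map (Algebra.TensorProduct.includeRight : M →ₐ[ℚ] FiniteAdeleRing (𝓞 ℚ) ℚ ⊗[ℚ] M) =
      (finiteAdelicForm L 3 H).map (finAdeleToTensor M j) := by
    ext i k
    rw [Matrix.map_apply, Matrix.map_apply, Matrix.map_apply, finiteAdelicForm, Matrix.map_apply,
      finAdeleToTensor_algebraMap]
    rfl
  have hconj : ((((u : GL (Fin 3) (FiniteAdeleRing (𝓞 L) L)) : Matrix (Fin 3) (Fin 3) _)).map (finAdeleToTensor M j)).map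
        (conjR M (FiniteAdeleRing (𝓞 ℚ) ℚ)) =
      ((((u : GL (Fin 3) (FiniteAdeleRing (𝓞 L) L)) : Matrix (Fin 3) (Fin 3) _)).map
        (conjFiniteAdele (↥(maximalRealSubfield L)) L (IsCMField.complexConj L))).map (finAdeleToTensor M j) := by
    ext i k
    simp only [Matrix.map_apply, finAdeleToTensor_conjFiniteAdele]
  rw [hcoe, hH, hconj, ← Matrix.transpose_map, ← Matrix.map_mul, ← Matrix.map_mul, hu]

/-- **Transport of `T₀(M)(𝔸_f) ≤ (𝔸_{M,f})ˣ` into `(𝔸_{ℚ,f} ⊗_ℚ M)ˣ`.** [cite: Deligne1979ShimuraVarieties, Prop. 2.3.10 (PDF p. 32)] -/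
def torusToTensorFin : ↥(torusFinAdelic M) →* (FiniteAdeleRing (𝓞 ℚ) ℚ ⊗[ℚ] M)ˣ :=
  (Units.map (ratFiniteAdeleTensorEquiv M).symm.toRingHom.toMonoidHom).comp (Subgroup.subtype _)

/-- The transported torus element satisfies `c(t)·t ∈ 𝔸_{ℚ,f}ˣ` («the torus factor keeping the similitude factor rational»).
[cite: Deligne1979ShimuraVarieties, Prop. 2.3.10 (PDF p. 32)] [cite: Liu2021, App. C Def. C.11] -/
theorem torusToTensorFin_cond (t : ↥(torusFinAdelic M)) :
    ∃ ν : (FiniteAdeleRing (𝓞 ℚ) ℚ)ˣ,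
      conjR M (FiniteAdeleRing (𝓞 ℚ) ℚ) (torusToTensorFin M t : FiniteAdeleRing (𝓞 ℚ) ℚ ⊗[ℚ] M) *
          (torusToTensorFin M t : FiniteAdeleRing (𝓞 ℚ) ℚ ⊗[ℚ] M) =
        algebraMap (FiniteAdeleRing (𝓞 ℚ) ℚ) (FiniteAdeleRing (𝓞 ℚ) ℚ ⊗[ℚ] M) (ν : FiniteAdeleRing (𝓞 ℚ) ℚ) := by
  obtain ⟨q, hq⟩ := t.2
  refine ⟨q, ?_⟩
  have hcoe : (torusToTensorFin M t : FiniteAdeleRing (𝓞 ℚ) ℚ ⊗[ℚ] M) =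
      (ratFiniteAdeleTensorEquiv M).symm ((t : (FiniteAdeleRing (𝓞 M) M)ˣ) : FiniteAdeleRing (𝓞 M) M) := rfl
  rw [hcoe, ← ratFiniteAdeleTensorEquiv_symm_conjFiniteAdele, ← map_mul, mul_comm, hq,
    ← finiteAdeleRing_mapSemialgHom_apply_eq_baseChange, RingEquiv.symm_apply_eq, Algebra.TensorProduct.algebraMap_apply,
    Algebra.algebraMap_self_apply, ratFiniteAdeleTensorEquiv_tmul, map_one, one_mul]

end Transport

/-! ### §3. The adelic group map `U(H)(𝔸_f) × T₀(M)(𝔸_f) → GSp_δ(𝔸_{ℚ,f})` -/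

section Fin

variable {L : Type} [Field L] [NumberField L] [IsCMField L] {M : Type} [Field M] [NumberField M] [IsCMField M]
  {j : L →+* M} {H : Matrix (Fin 3) (Fin 3) L} {ξ₀ ξ : M} {g : ℕ} {δ : Fin g → ℕ}

/-- **The group-map carrier on finite adèles `(a, t) ↦ (t, t·(a ⊗ 1))` read in the frame: `U(H)(𝔸_f) × T₀(M)(𝔸_f) →* GSp_δ(𝔸_{ℚ,f})`**
(★ `gspFinAdelic δ`), i.e. R-f's `(a ⊗ t_p, t_p)`. [cite: Deligne1979ShimuraVarieties, Prop. 2.3.10 (PDF p. 32)] [cite: Milne2005ShimuraVarieties, §5 p. 57] -/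
def auxToGspFin (F : SymplecticFrame M j H ξ₀ ξ g δ) :
    ↥(finAdelic (↥(maximalRealSubfield L)) L (IsCMField.complexConj L) 3 H) × ↥(torusFinAdelic M) →* ↥(gspFinAdelic δ) :=
  ((auxRep (FiniteAdeleRing (𝓞 ℚ) ℚ) F).comp
      (MonoidHom.prod ((torusToTensorFin M).comp (MonoidHom.snd _ _)) ((unitaryToTensorFin M j H).comp (MonoidHom.fst _ _)))).codRestrict
    _ fun p => auxRep_mem_similitudeGroupOfForm (FiniteAdeleRing (𝓞 ℚ) ℚ) F (torusToTensorFin_cond M p.2)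
      (unitaryToTensorFin_unitary M j H p.1)

/-- Underlying element of `auxToGspFin`. [cite: Deligne1979ShimuraVarieties, Prop. 2.3.10 (PDF p. 32)] -/
theorem coe_auxToGspFin (F : SymplecticFrame M j H ξ₀ ξ g δ)
    (a : ↥(finAdelic (↥(maximalRealSubfield L)) L (IsCMField.complexConj L) 3 H)) (t : ↥(torusFinAdelic M)) :
    (auxToGspFin F (a, t) : GL (Fin g ⊕ Fin g) (FiniteAdeleRing (𝓞 ℚ) ℚ)) =
      auxRep (FiniteAdeleRing (𝓞 ℚ) ℚ) F (torusToTensorFin M t, unitaryToTensorFin M j H a) := rfl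

/-- **The auxiliary level `K̃(m) := ũ_β⁻¹(K_δ(m)) ≤ U(H)(𝔸_f) × T₀(M)(𝔸_f)`** (planner delta Δ1 / RECEPTACLE-PLAN §7.2:
the principal pairs `(K̃(m), K_δ(m))` at which the embedding is read; `K̃(m) ∩ (K × L₀)` is the level of the Ext tower
`T(m)`).  A `Subgroup.comap`; openness and the product decomposition are lemmas for the S2pair prover.
[cite: Deligne1971TravauxShimura, Prop. 1.15 p. 132 («K₂ ⊃ u(K₁)»)] [cite: Deligne1979ShimuraVarieties, 2.1.2 (PDF p. 24)] -/
def auxLevel (F : SymplecticFrame M j H ξ₀ ξ g δ) (m : ℕ) :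
    Subgroup (↥(finAdelic (↥(maximalRealSubfield L)) L (IsCMField.complexConj L) 3 H) × ↥(torusFinAdelic M)) :=
  (principalLevelSubgroup δ m).comap (auxToGspFin F)

/-- Membership in `K̃(m)`: `ũ_β(a, t) ∈ K_δ(m)`. [cite: Deligne1971TravauxShimura, Prop. 1.15 p. 132] -/
theorem mem_auxLevel_iff (F : SymplecticFrame M j H ξ₀ ξ g δ) (m : ℕ)
    (p : ↥(finAdelic (↥(maximalRealSubfield L)) L (IsCMField.complexConj L) 3 H) × ↥(torusFinAdelic M)) :
    p ∈ auxLevel F m ↔ auxToGspFin F p ∈ principalLevelSubgroup δ m :=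
  Iff.rfl

/-- `K̃(m′) ≤ K̃(m)` for `m ∣ m′`. [cite: Deligne1971TravauxShimura, 1.8 p. 129] -/
theorem auxLevel_anti (F : SymplecticFrame M j H ξ₀ ξ g δ) {m m' : ℕ} (h : m ∣ m') : auxLevel F m' ≤ auxLevel F m :=
  fun p hp => (mem_auxLevel_iff F m p).2 (principalLevelSubgroup_anti δ h ((mem_auxLevel_iff F m' p).1 hp))

end Fin

/-! ### §4. The rational group map `U(H)(ℚ) × T₀(M)(ℚ) → GSp_δ(ℚ)` -/

section Rat

variable {L : Type} [Field L] [NumberField L] [IsCMField L] (M : Type) [Field M] [NumberField M] [IsCMField M]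
  (j : L →+* M) (H : Matrix (Fin 3) (Fin 3) L)

/-- `L → ℚ ⊗_ℚ M`, `a ↦ 1 ⊗ j(a)`. [cite: Deligne1979ShimuraVarieties, Prop. 2.3.10 (PDF p. 32)] -/
def ratToTensor : L →+* ℚ ⊗[ℚ] M :=
  ((Algebra.TensorProduct.includeRight : M →ₐ[ℚ] ℚ ⊗[ℚ] M) : M →+* ℚ ⊗[ℚ] M).comp j

omit [NumberField L] [IsCMField L] [IsCMField M] in
/-- `ratToTensor a = 1 ⊗ j a`. [cite: Deligne1979ShimuraVarieties, Prop. 2.3.10 (PDF p. 32)] -/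
@[simp] theorem ratToTensor_apply (a : L) : ratToTensor M j a = (1 : ℚ) ⊗ₜ j a := rfl

/-- `ratToTensor` intertwines `c_L` with `1 ⊗ c_M`. [cite: Deligne1979ShimuraVarieties, 2.3.9 (PDF p. 32)] -/
theorem ratToTensor_complexConj (a : L) :
    ratToTensor M j (IsCMField.complexConj L a) = conjR M ℚ (ratToTensor M j a) := by
  rw [ratToTensor_apply, ratToTensor_apply, conjR_tmul, ringHom_complexConj M j]

/-- **Transport of `U(H)(ℚ) ≤ GL₃(L)` into `GL₃(ℚ ⊗_ℚ M)`.** [cite: Deligne1979ShimuraVarieties, Prop. 2.3.10 (PDF p. 32)] -/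
def unitaryToTensorRat :
    ↥(rational (↥(maximalRealSubfield L)) L (IsCMField.complexConj L) 3 H) →* GL (Fin 3) (ℚ ⊗[ℚ] M) :=
  (Matrix.GeneralLinearGroup.map (ratToTensor M j)).comp (Subgroup.subtype _)

/-- The transported rational element is unitary for `H^j` over `ℚ ⊗ M` (convention `1 ⊗ c`). [cite: Deligne1979ShimuraVarieties, Prop. 2.3.10 (PDF p. 32)] -/
theorem unitaryToTensorRat_unitary (u : ↥(rational (↥(maximalRealSubfield L)) L (IsCMField.complexConj L) 3 H)) :
    ((unitaryToTensorRat M j H u : Matrix (Fin 3) (Fin 3) (ℚ ⊗[ℚ] M)).map (conjR M ℚ))ᵀ *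
        (H.map j).map (Algebra.TensorProduct.includeRight : M →ₐ[ℚ] ℚ ⊗[ℚ] M) *
        (unitaryToTensorRat M j H u : Matrix (Fin 3) (Fin 3) (ℚ ⊗[ℚ] M)) =
      (H.map j).map (Algebra.TensorProduct.includeRight : M →ₐ[ℚ] ℚ ⊗[ℚ] M) := by
  have hu : (((u : GL (Fin 3) L) : Matrix (Fin 3) (Fin 3) L).map
        ((IsCMField.complexConj L : L ≃ₐ[↥(maximalRealSubfield L)] L) : L →+* L))ᵀ * H *
        ((u : GL (Fin 3) L) : Matrix (Fin 3) (Fin 3) L) = H := u.2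
  have hcoe : (unitaryToTensorRat M j H u : Matrix (Fin 3) (Fin 3) (ℚ ⊗[ℚ] M)) =
      (((u : GL (Fin 3) L)) : Matrix (Fin 3) (Fin 3) L).map (ratToTensor M j) := rfl
  have hH : (H.map j).map (Algebra.TensorProduct.includeRight : M →ₐ[ℚ] ℚ ⊗[ℚ] M) = H.map (ratToTensor M j) := by
    ext i k
    rfl
  have hconj : ((((u : GL (Fin 3) L)) : Matrix (Fin 3) (Fin 3) L).map (ratToTensor M j)).map (conjR M ℚ) =
      ((((u : GL (Fin 3) L)) : Matrix (Fin 3) (Fin 3) L).map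
        ((IsCMField.complexConj L : L ≃ₐ[↥(maximalRealSubfield L)] L) : L →+* L)).map (ratToTensor M j) := by
    ext i k
    simp only [Matrix.map_apply, RingHom.coe_coe]
    exact (ratToTensor_complexConj M j _).symm
  rw [hcoe, hH, hconj, ← Matrix.transpose_map, ← Matrix.map_mul, ← Matrix.map_mul, hu]

/-- **Transport of `T₀(M)(ℚ) ≤ Mˣ` into `(ℚ ⊗_ℚ M)ˣ`.** [cite: Deligne1979ShimuraVarieties, Prop. 2.3.10 (PDF p. 32)] -/
def torusToTensorRat : ↥(torusRat M) →* (ℚ ⊗[ℚ] M)ˣ :=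
  (Units.map ((Algebra.TensorProduct.includeRight : M →ₐ[ℚ] ℚ ⊗[ℚ] M) : M →* ℚ ⊗[ℚ] M)).comp (Subgroup.subtype _)

/-- The transported rational torus element satisfies `c(t)·t ∈ ℚˣ`. [cite: Liu2021, App. C Def. C.11] -/
theorem torusToTensorRat_cond (t : ↥(torusRat M)) :
    ∃ ν : ℚˣ, conjR M ℚ (torusToTensorRat M t : ℚ ⊗[ℚ] M) * (torusToTensorRat M t : ℚ ⊗[ℚ] M) =
      algebraMap ℚ (ℚ ⊗[ℚ] M) (ν : ℚ) := by
  obtain ⟨q, hq⟩ := t.2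
  refine ⟨q, ?_⟩
  have hcoe : (torusToTensorRat M t : ℚ ⊗[ℚ] M) = (1 : ℚ) ⊗ₜ ((t : Mˣ) : M) := rfl
  rw [hcoe, conjR_tmul, Algebra.TensorProduct.tmul_mul_tmul, one_mul, mul_comm, hq,
    Algebra.TensorProduct.algebraMap_apply, Algebra.algebraMap_self_apply, Algebra.algebraMap_eq_smul_one,
    TensorProduct.tmul_smul, TensorProduct.smul_tmul', smul_eq_mul, mul_one]

variable {M j H} {ξ₀ ξ : M} {g : ℕ} {δ : Fin g → ℕ}

/-- **The group-map carrier on rational points `U(H)(ℚ) × T₀(M)(ℚ) →* GSp_δ(ℚ)`** (★ `gspRational δ`).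
[cite: Deligne1979ShimuraVarieties, Prop. 2.3.10 (PDF p. 32)] [cite: Milne2005ShimuraVarieties, §5 p. 57] -/
def auxToGspRat (F : SymplecticFrame M j H ξ₀ ξ g δ) :
    ↥(rational (↥(maximalRealSubfield L)) L (IsCMField.complexConj L) 3 H) × ↥(torusRat M) →* ↥(gspRational δ) :=
  ((auxRep ℚ F).comp
      (MonoidHom.prod ((torusToTensorRat M).comp (MonoidHom.snd _ _)) ((unitaryToTensorRat M j H).comp (MonoidHom.fst _ _)))).codRestrict
    _ fun p => auxRep_mem_similitudeGroupOfForm ℚ F (torusToTensorRat_cond M p.2) (unitaryToTensorRat_unitary M j H p.1)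

/-- Underlying element of `auxToGspRat`. [cite: Deligne1979ShimuraVarieties, Prop. 2.3.10 (PDF p. 32)] -/
theorem coe_auxToGspRat (F : SymplecticFrame M j H ξ₀ ξ g δ)
    (a : ↥(rational (↥(maximalRealSubfield L)) L (IsCMField.complexConj L) 3 H)) (t : ↥(torusRat M)) :
    (auxToGspRat F (a, t) : GL (Fin g ⊕ Fin g) ℚ) = auxRep ℚ F (torusToTensorRat M t, unitaryToTensorRat M j H a) := rfl

end Rat

/-! ### §5. Naturality of `auxRep` in `R` and the square `ℚ → 𝔸_{ℚ,f}` -/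

section Natural

variable {L : Type} [Field L] (M : Type) [Field M] [NumberField M] [IsCMField M]
  {R R' : Type} [CommRing R] [Algebra ℚ R] [CommRing R'] [Algebra ℚ R'] (φ : R →ₐ[ℚ] R')

omit [IsCMField M] in
/-- Coordinates in the basis `1 ⊗ b_k` commute with base change along `φ ⊗ 1`. [cite: Deligne1971TravauxShimura, 4.9 p. 147] -/
theorem basis_repr_map (z : R ⊗[ℚ] M) (k : Fin (Module.finrank ℚ M)) :
    (Algebra.TensorProduct.basis R' (ratBasis M)).repr (Algebra.TensorProduct.map φ (AlgHom.id ℚ M) z) k =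
      φ ((Algebra.TensorProduct.basis R (ratBasis M)).repr z k) := by
  induction z using TensorProduct.induction_on with
  | zero => simp
  | tmul r m =>
      rw [Algebra.TensorProduct.map_tmul, AlgHom.id_apply, Algebra.TensorProduct.basis_repr_tmul,
        Algebra.TensorProduct.basis_repr_tmul, Finsupp.smul_apply, Finsupp.smul_apply, Finsupp.mapRange_apply,
        Finsupp.mapRange_apply, smul_eq_mul, smul_eq_mul, map_mul, AlgHom.commutes]
  | add a b ha hb => rw [map_add, map_add, Finsupp.add_apply, ha, hb, map_add, Finsupp.add_apply, map_add]

omit [IsCMField M] in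
/-- **Restriction of scalars is natural in `R`**: `resMatrix` along `1 ⊗ b` commutes with `φ ⊗ 1`. [cite: Deligne1971TravauxShimura, 4.9 p. 147] -/
theorem resMatrix_map {m : Type} [Fintype m] [DecidableEq m] (A : Matrix m m (R ⊗[ℚ] M)) :
    (resMatrix (Algebra.TensorProduct.basis R (ratBasis M)) A).map φ =
      resMatrix (Algebra.TensorProduct.basis R' (ratBasis M)) (A.map (Algebra.TensorProduct.map φ (AlgHom.id ℚ M))) := by
  ext ⟨i, k⟩ ⟨i', l⟩
  rw [Matrix.map_apply, resMatrix_apply, resMatrix_apply, Matrix.map_apply, Algebra.TensorProduct.basis_apply,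
    Algebra.TensorProduct.basis_apply, ← basis_repr_map M φ, map_mul, Algebra.TensorProduct.map_tmul, map_one,
    AlgHom.id_apply]

omit [NumberField M] [IsCMField M] in
/-- `blockGL` is natural in the ring. [cite: Deligne1979ShimuraVarieties, Prop. 2.3.10 (PDF p. 32)] -/
theorem coe_blockGL_map {S S' : Type} [CommRing S] [CommRing S'] (ψ : S →+* S') (t : Sˣ) (X : GL (Fin 3) S) :
    (((blockGL S (t, X) : GL (Fin 1 ⊕ Fin 3) S) : Matrix (Fin 1 ⊕ Fin 3) (Fin 1 ⊕ Fin 3) S).map ψ) =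
      ((blockGL S' (Units.map (ψ : S →* S') t, Matrix.GeneralLinearGroup.map ψ X) : GL (Fin 1 ⊕ Fin 3) S') :
        Matrix (Fin 1 ⊕ Fin 3) (Fin 1 ⊕ Fin 3) S') := by
  rw [coe_blockGL, coe_blockGL, Matrix.fromBlocks_map]
  refine Matrix.fromBlocks_inj.2 ⟨?_, ?_, ?_, ?_⟩
  · ext a b
    simp [Matrix.one_apply, apply_ite ψ]
  · exact Matrix.map_zero ψ (map_zero ψ)
  · exact Matrix.map_zero ψ (map_zero ψ)
  · ext a b
    simp

variable {M} {j : L →+* M} {H : Matrix (Fin 3) (Fin 3) L} {ξ₀ ξ : M} {g : ℕ} {δ : Fin g → ℕ}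

/-- **Naturality of `auxRep` in `R`**: for `φ : R →ₐ[ℚ] R′`, `GL(φ) ∘ auxRep_R = auxRep_{R′} ∘ (φ ⊗ 1)`.
[cite: Deligne1979ShimuraVarieties, Prop. 2.3.10 (PDF p. 32)] [cite: Deligne1971TravauxShimura, 4.9 p. 147] -/
theorem map_auxRep (F : SymplecticFrame M j H ξ₀ ξ g δ) (t : (R ⊗[ℚ] M)ˣ) (X : GL (Fin 3) (R ⊗[ℚ] M)) :
    Matrix.GeneralLinearGroup.map (φ : R →+* R') (auxRep R F (t, X)) =
      auxRep R' F (Units.map ((Algebra.TensorProduct.map φ (AlgHom.id ℚ M) : R ⊗[ℚ] M →ₐ[ℚ] R' ⊗[ℚ] M) :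
          R ⊗[ℚ] M →* R' ⊗[ℚ] M) t,
        Matrix.GeneralLinearGroup.map
          ((Algebra.TensorProduct.map φ (AlgHom.id ℚ M) : R ⊗[ℚ] M →ₐ[ℚ] R' ⊗[ℚ] M) : R ⊗[ℚ] M →+* R' ⊗[ℚ] M) X) := by
  apply Units.ext
  change (((auxRep R F (t, X) : GL (Fin g ⊕ Fin g) R) : Matrix (Fin g ⊕ Fin g) (Fin g ⊕ Fin g) R).map φ) = _
  rw [auxRep, auxRep, MonoidHom.comp_apply, MonoidHom.comp_apply, MonoidHom.comp_apply, MonoidHom.comp_apply,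
    coe_conjRect, coe_conjRect, coe_resGL, coe_resGL, Matrix.map_mul, Matrix.map_mul]
  have hP : (framePR R F).map φ = framePR R' F := by
    rw [framePR, framePR, Matrix.map_map]; congr 1; funext q; exact φ.commutes q
  have hQ : (frameQR R F).map φ = frameQR R' F := by
    rw [frameQR, frameQR, Matrix.map_map]; congr 1; funext q; exact φ.commutes q
  rw [hP, hQ, resMatrix_map M φ]
  congr 1; congr 1; congr 1
  exact coe_blockGL_map ((Algebra.TensorProduct.map φ (AlgHom.id ℚ M) : R ⊗[ℚ] M →ₐ[ℚ] R' ⊗[ℚ] M) :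
    R ⊗[ℚ] M →+* R' ⊗[ℚ] M) t X

end Natural

/-! ### §6. The compatibility square with the diagonal embeddings -/

section Square

variable {L : Type} [Field L] [NumberField L] [IsCMField L] {M : Type} [Field M] [NumberField M] [IsCMField M]
  {j : L →+* M} {H : Matrix (Fin 3) (Fin 3) L} {ξ₀ ξ : M} {g : ℕ} {δ : Fin g → ℕ}

omit [IsCMField M] in
/-- The diagonal `ℚ ⊗ M → 𝔸_{ℚ,f} ⊗ M` and the transports: `(ι ⊗ 1)(1 ⊗ a) = e⁻¹((a)_{𝔸_{M,f}})`. [cite: CasselsFrohlichANT1967, Ch. II §14 (14.2)] -/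
theorem tensorMap_ofId_one_tmul (a : M) :
    Algebra.TensorProduct.map (Algebra.ofId ℚ (FiniteAdeleRing (𝓞 ℚ) ℚ)) (AlgHom.id ℚ M) ((1 : ℚ) ⊗ₜ a) =
      (ratFiniteAdeleTensorEquiv M).symm (algebraMap M (FiniteAdeleRing (𝓞 M) M) a) := by
  rw [Algebra.TensorProduct.map_tmul, map_one, AlgHom.id_apply, ratFiniteAdeleTensorEquiv_symm_algebraMap]

/-- **The square commutes**: `GSp_δ(ℚ) → GSp_δ(𝔸_f)` ∘ `auxToGspRat` = `auxToGspFin` ∘ (`U(H)(ℚ) → U(H)(𝔸_f)` × `T₀(ℚ) → T₀(𝔸_f)`)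
(★ `gspRationalToFinAdelic`, ★ `rationalToFinAdelic`, ★ `toTorusFinAdelic`) — the datum needed for the Shimura-set map of
(g-b) to be well defined on double cosets. [cite: Deligne1979ShimuraVarieties, 2.1.2 (PDF p. 24)] [cite: Milne2005ShimuraVarieties, §5 p. 57] -/
theorem gspRationalToFinAdelic_auxToGspRat (F : SymplecticFrame M j H ξ₀ ξ g δ)
    (a : ↥(rational (↥(maximalRealSubfield L)) L (IsCMField.complexConj L) 3 H)) (t : ↥(torusRat M)) :
    gspRationalToFinAdelic δ (auxToGspRat F (a, t)) =
      auxToGspFin F (rationalToFinAdelic (↥(maximalRealSubfield L)) L (IsCMField.complexConj L) 3 H a,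
        toTorusFinAdelic M t) := by
  apply Subtype.ext
  rw [coe_gspRationalToFinAdelic, coe_auxToGspRat, coe_auxToGspFin]
  have h := map_auxRep (Algebra.ofId ℚ (FiniteAdeleRing (𝓞 ℚ) ℚ)) F (torusToTensorRat M t) (unitaryToTensorRat M j H a)
  have hφ : ((Algebra.ofId ℚ (FiniteAdeleRing (𝓞 ℚ) ℚ) : ℚ →ₐ[ℚ] FiniteAdeleRing (𝓞 ℚ) ℚ) : ℚ →+* _) =
      algebraMap ℚ (FiniteAdeleRing (𝓞 ℚ) ℚ) := rfl
  rw [hφ] at h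
  rw [h]
  congr 2
  · apply Units.ext
    change Algebra.TensorProduct.map _ _ ((1 : ℚ) ⊗ₜ ((t : Mˣ) : M)) = (ratFiniteAdeleTensorEquiv M).symm _
    rw [tensorMap_ofId_one_tmul, Subgroup.subtype_apply, coe_toTorusFinAdelic, FiniteAdeleRing.unitEmbedding_apply]
  · apply Units.ext
    ext i k
    change Algebra.TensorProduct.map _ _ ((1 : ℚ) ⊗ₜ j (((a : GL (Fin 3) L) : Matrix (Fin 3) (Fin 3) L) i k)) =
      finAdeleToTensor M j ((((rationalToFinAdelic (↥(maximalRealSubfield L)) L (IsCMField.complexConj L) 3 H a :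
        finAdelic _ L _ 3 H) : GL (Fin 3) (FiniteAdeleRing (𝓞 L) L)) : Matrix (Fin 3) (Fin 3) _) i k)
    rw [coe_rationalToFinAdelic]
    change _ = finAdeleToTensor M j (algebraMap L (FiniteAdeleRing (𝓞 L) L) (((a : GL (Fin 3) L) : Matrix (Fin 3) (Fin 3) L) i k))
    rw [finAdeleToTensor_algebraMap, Algebra.TensorProduct.map_tmul, map_one, AlgHom.id_apply]

end Square

end Aux

end UnitaryCanonicalModel

end Literature.AlgebraicGeometry.ShimuraVarieties

end
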